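import Summits.QuantumAdvantage.QuantumAdvantage.Theorems.PurityDialLawI
import Summits.QuantumAdvantage.AdviceFreeQNC0.AffBells22CoordProduct

/-! # PurityDialLawJ — part 10/13 (mechanical split for landing of `PurityDialLaw`; content verbatim; scopes re-opened with their variables) -/

set_option linter.dupNamespace false
noncomputable section

namespace Summit.QuantumAdvantage.QuantumAdvantage.Theorems.PurityDialLaw
open Classical Finset Summit.QuantumAdvantage.AdviceFreeQNC0
open Literature.Computability.MetaComplexity Literature.Computability.MetaComplexity.Smolensky
open Literature.Computability.Complexity (parityFn)

section LinearForms

variable {m : ℕ}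

/-- the analytic input, general form: `Q · (2cos(π/2p))^m ≤ 2^m` once `Q ≤ 2^L` and `m ≥ 2p²L`. -/
theorem cos_pow_le_of_log (p m Q L : ℕ) (hp : 1 ≤ p) (hQ : Q ≤ 2 ^ L) (hm : 2 * p ^ 2 * L ≤ m) :
    (Q : ℝ) * (2 * Real.cos (Real.pi / (2 * p))) ^ m ≤ 2 ^ m := by
  have hqR : (1 : ℝ) ≤ p := by exact_mod_cast hp
  have hπ := Real.pi_pos
  have hx : |Real.pi / (2 * p)| ≤ Real.pi := by
    rw [abs_of_nonneg (by positivity)]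
    rw [div_le_iff₀ (by positivity)]; nlinarith
  have hcos_le : Real.cos (Real.pi / (2 * p)) ≤ 1 - 1 / (2 * (p : ℝ) ^ 2) := by
    refine (Real.cos_le_one_sub_mul_cos_sq hx).trans (le_of_eq ?_)
    field_simp
  have hcos_nn : 0 ≤ Real.cos (Real.pi / (2 * p)) := by
    apply Real.cos_nonneg_of_neg_pi_div_two_le_of_le
    · linarith [show 0 ≤ Real.pi / (2 * p) by positivity]
    · rw [div_le_div_iff_of_pos_left hπ (by positivity) (by norm_num)]; linarith
  set y : ℝ := 1 / (2 * (p : ℝ) ^ 2) with hy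
  have hy0 : 0 ≤ y := by positivity
  have hy1 : y ≤ 1 / 2 := by
    rw [hy, div_le_div_iff_of_pos_left (by norm_num) (by positivity) (by norm_num)]; nlinarith
  have h1 : (2 * Real.cos (Real.pi / (2 * p))) ^ m ≤ (2 * (1 - y)) ^ m :=
    pow_le_pow_left₀ (by positivity) (by linarith) m
  have h2 : (1 - y) ^ m ≤ Real.exp (-y) ^ m := pow_le_pow_left₀ (by linarith) (Real.one_sub_le_exp_neg y) m
  have h3 : Real.exp (-y) ^ m = Real.exp (-(m * y)) := by rw [← Real.exp_nat_mul]; ring_nf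
  have hmy : (L : ℝ) ≤ m * y := by
    rw [hy]
    have : (2 * p ^ 2 * L : ℝ) ≤ m := by exact_mod_cast hm
    rw [show (m : ℝ) * (1 / (2 * (p : ℝ) ^ 2)) = m / (2 * (p : ℝ) ^ 2) by ring,
      le_div_iff₀ (by positivity)]
    linarith
  have hQL : (Q : ℝ) ≤ 2 ^ L := by exact_mod_cast hQ
  have hexpL : (2 : ℝ) ^ L ≤ Real.exp L := by
    rw [show (L : ℝ) = L * 1 by ring, Real.exp_nat_mul]
    exact pow_le_pow_left₀ (by norm_num) (by have := Real.add_one_le_exp 1; linarith) L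
  have hexp : (Q : ℝ) ≤ Real.exp (m * y) := hQL.trans (hexpL.trans (Real.exp_le_exp.2 hmy))
  have hpos : (0 : ℝ) < Real.exp (m * y) := Real.exp_pos _
  calc (Q : ℝ) * (2 * Real.cos (Real.pi / (2 * p))) ^ m
      ≤ Q * (2 * (1 - y)) ^ m := by gcongr
    _ = 2 ^ m * (Q * (1 - y) ^ m) := by rw [mul_pow]; ring
    _ ≤ 2 ^ m * (Q * Real.exp (-(m * y))) := by rw [← h3]; gcongr
    _ ≤ 2 ^ m * 1 := by
        gcongr
        rw [Real.exp_neg, ← div_eq_mul_inv, div_le_one hpos]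
        exact hexp
    _ = 2 ^ m := mul_one _

/-- the parity sign as a character power: `χ₂(1)^{wt u} = (if parity u then −1 else 1)`. -/
theorem stdAddChar_pow_wt (u : Fin m → Bool) :
    (ZMod.stdAddChar (1 : ZMod 2) : ℂ) ^ (univ.filter fun i => u i = true).card =
      if parityFn m u = true then -1 else 1 := by
  rw [Summit.QuantumAdvantage.AdviceFreeQNC0.AffBells22.stdAddChar_one_zmod_two, parityFn_eq_decide_wt]
  unfold wt
  rcases Nat.even_or_odd (univ.filter fun i => u i = true).card with h | h
  · rw [h.neg_one_pow, if_neg]; rw [Nat.even_iff.mp h]; decide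
  · rw [h.neg_one_pow, if_pos]; rw [Nat.odd_iff.mp h]; decide

/-- the values of `K` linear forms `mod p` on a point of the cube: `ℓ_j(u) = Σ_{i : u i} λ_{j,i}`. -/
def linForms {p K : ℕ} (lam : Fin K → Fin m → ZMod p) (u : Fin m → Bool) : Fin K → ZMod p :=
  fun j => ∑ i, if u i then lam j i else 0

/-- **a function of `K` linear forms `mod p`**: `u ↦ φ(ℓ_1(u), …, ℓ_K(u))` — weight readers `mod p` (`K = 1`,
`λ ≡ 1`), one-form readers with ARBITRARY coefficients (`K = 1`), and every Boolean combination of `K` such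
(in general ASYMMETRIC and, for large `K`, SPARSE: a cell has density `≈ p^{-K}`). -/
def ofForms {p K : ℕ} (lam : Fin K → Fin m → ZMod p) (φ : (Fin K → ZMod p) → Bool) : (Fin m → Bool) → Bool :=
  fun u => φ (linForms lam u)

/-- **CELL SIGN SUMS ARE EXPONENTIALLY SMALL (PROVED, from the tree's two-moduli exponential sums):** for an odd
prime `p`, `K` linear forms `λ` and any cell label `v`,
`|Σ_{u : ℓ⃗(u) = v} (−1)^{|u|}| ≤ (2cos(π/2p))^m` — expand the cell in characters of `(ℤ/p)^K`
(`TwoModuli.sum_cell_eq_sum_twisted`); each twisted cube sum factorises (`TwoModuli.norm_cubeSum_le_of_ne_zero` with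
`N = 2`): a coordinate outside the support of the combined form contributes `|1 + χ₂(1)| = 2cos(π/2) = 0`, one inside
contributes `≤ 2cos(π/2p)`. -/
theorem norm_cell_sign_sum_le_mod (p : ℕ) [NeZero p] (hp2c : p.Coprime 2) {K : ℕ} (lam : Fin K → Fin m → ZMod p)
    (v : Fin K → ZMod p) :
    ‖∑ u : Fin m → Bool, (if linForms lam u = v then
        (ZMod.stdAddChar (1 : ZMod 2) : ℂ) ^ (univ.filter fun i => u i = true).card else 0)‖
      ≤ (2 * Real.cos (Real.pi / (2 * p))) ^ m := by
  have hcell := TwoModuli.sum_cell_eq_sum_twisted lam v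
    (fun u : Fin m → Bool => (ZMod.stdAddChar (1 : ZMod 2) : ℂ) ^ (univ.filter fun i => u i = true).card)
  have hlhs : (∑ u : Fin m → Bool, (if linForms lam u = v then
        (ZMod.stdAddChar (1 : ZMod 2) : ℂ) ^ (univ.filter fun i => u i = true).card else 0)) =
      ∑ u : Fin m → Bool, (if (fun j => ∑ i, if u i then lam j i else 0) = v then
        (ZMod.stdAddChar (1 : ZMod 2) : ℂ) ^ (univ.filter fun i => u i = true).card else 0) := rfl
  rw [hlhs, hcell]
  set c : ℝ := 2 * Real.cos (Real.pi / (2 * p)) with hc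
  have hπ := Real.pi_pos
  have hp1 : (1 : ℝ) ≤ p := by exact_mod_cast Nat.pos_of_ne_zero (NeZero.ne p)
  have hc0 : 0 ≤ c := by
    rw [hc]
    refine mul_nonneg (by norm_num) (Real.cos_nonneg_of_neg_pi_div_two_le_of_le ?_ ?_)
    · linarith [show 0 ≤ Real.pi / (2 * p) by positivity]
    · rw [div_le_div_iff_of_pos_left hπ (by positivity) (by norm_num)]; linarith
  have hone : ∀ x : ZMod p, ‖(ZMod.stdAddChar x : ℂ)‖ = 1 := fun x => by
    rw [ZMod.stdAddChar_apply]; exact Circle.norm_coe _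
  -- every twisted sum is `≤ c^m`
  have hterm : ∀ γ : Fin K → ZMod p,
      ‖(ZMod.stdAddChar (-∑ j, γ j * v j) : ℂ) *
        ∑ u : Fin m → Bool, (ZMod.stdAddChar (∑ i, if u i then ∑ j, γ j * lam j i else 0) : ℂ) *
          (ZMod.stdAddChar (1 : ZMod 2) : ℂ) ^ (univ.filter fun i => u i = true).card‖ ≤ c ^ m := by
    intro γ
    rw [norm_mul, hone, one_mul]
    have h := TwoModuli.norm_cubeSum_le_of_ne_zero hp2c (fun i => ∑ j, γ j * lam j i) (m := (1 : ZMod 2))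
      (by decide)
    refine h.trans ?_
    set s := (univ.filter fun i : Fin m => (∑ j, γ j * lam j i) ≠ 0).card with hs
    have hsm : s ≤ m := (card_le_univ _).trans (by rw [Fintype.card_fin])
    rw [Fintype.card_fin, show ((p : ℝ) * (2 : ℕ)) = 2 * p by push_cast; ring, Nat.cast_ofNat,
      Real.cos_pi_div_two, mul_zero]
    calc c ^ s * (0 : ℝ) ^ (m - s) ≤ c ^ s * c ^ (m - s) := by
          gcongr
      _ = c ^ m := by rw [← pow_add, Nat.add_sub_cancel' hsm]
  have hK : (Fintype.card (Fin K → ZMod p) : ℝ) = (p : ℝ) ^ K := by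
    rw [Fintype.card_fun, ZMod.card, Fintype.card_fin]; push_cast; ring
  have hpK : (0 : ℝ) < (p : ℝ) ^ K := by positivity
  calc ‖((p : ℂ) ^ K)⁻¹ * ∑ γ : Fin K → ZMod p, (ZMod.stdAddChar (-∑ j, γ j * v j) : ℂ) *
          ∑ u : Fin m → Bool, (ZMod.stdAddChar (∑ i, if u i then ∑ j, γ j * lam j i else 0) : ℂ) *
            (ZMod.stdAddChar (1 : ZMod 2) : ℂ) ^ (univ.filter fun i => u i = true).card‖
      ≤ ((p : ℝ) ^ K)⁻¹ * ∑ γ : Fin K → ZMod p, c ^ m := by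
        rw [norm_mul, norm_inv, norm_pow, Complex.norm_natCast]
        gcongr
        exact (norm_sum_le _ _).trans (sum_le_sum fun γ _ => hterm γ)
    _ = c ^ m := by
        rw [sum_const, card_univ, nsmul_eq_mul, hK, ← mul_assoc, inv_mul_cancel₀ hpK.ne', one_mul]

/-- prime-modulus form of `norm_cell_sign_sum_le_mod`. -/
theorem norm_cell_sign_sum_le (p : ℕ) [hp : Fact p.Prime] (hp2 : p ≠ 2) {K : ℕ} (lam : Fin K → Fin m → ZMod p)
    (v : Fin K → ZMod p) :
    ‖∑ u : Fin m → Bool, (if linForms lam u = v then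
        (ZMod.stdAddChar (1 : ZMod 2) : ℂ) ^ (univ.filter fun i => u i = true).card else 0)‖
      ≤ (2 * Real.cos (Real.pi / (2 * p))) ^ m := by
  haveI : NeZero p := ⟨hp.out.ne_zero⟩
  exact norm_cell_sign_sum_le_mod p ((Nat.coprime_primes hp.out Nat.prime_two).2 hp2) lam v

/-- **THE BIAS OF A FUNCTION OF `K` LINEAR FORMS modulo ANY ODD `q` (PROVED):**
`|#even f − #odd f| ≤ q^K · (2cos(π/2q))^m`. -/
theorem abs_sub_parts_ofForms_le_mod (p : ℕ) [NeZero p] (hp2 : p.Coprime 2) {K : ℕ} (lam : Fin K → Fin m → ZMod p)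
    (φ : (Fin K → ZMod p) → Bool) :
    |((evenPart (ofForms lam φ)).card : ℝ) - (oddPart (ofForms lam φ)).card| ≤
      (p : ℝ) ^ K * (2 * Real.cos (Real.pi / (2 * p))) ^ m := by
  set sgn : (Fin m → Bool) → ℂ := fun u =>
    (ZMod.stdAddChar (1 : ZMod 2) : ℂ) ^ (univ.filter fun i => u i = true).card with hsgn
  -- `E − O` as a signed sum
  have hEO : (((evenPart (ofForms lam φ)).card : ℝ) : ℂ) - (((oddPart (ofForms lam φ)).card : ℝ) : ℂ) =
      ∑ u : Fin m → Bool, (if ofForms lam φ u = true then sgn u else 0) := by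
    have hE : (((evenPart (ofForms lam φ)).card : ℝ) : ℂ) =
        ∑ u : Fin m → Bool, (if ofForms lam φ u = true ∧ parityFn m u = false then (1 : ℂ) else 0) := by
      unfold evenPart; rw [Complex.ofReal_natCast, natCast_card_filter]
    have hO : (((oddPart (ofForms lam φ)).card : ℝ) : ℂ) =
        ∑ u : Fin m → Bool, (if ofForms lam φ u = true ∧ parityFn m u = true then (1 : ℂ) else 0) := by
      unfold oddPart; rw [Complex.ofReal_natCast, natCast_card_filter]
    rw [hE, hO, ← sum_sub_distrib]
    refine sum_congr rfl fun u _ => ?_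
    rw [hsgn]; dsimp only; rw [stdAddChar_pow_wt]
    cases ofForms lam φ u <;> cases parityFn m u <;> simp
  -- regroup by cells
  have hcells : ∑ u : Fin m → Bool, (if ofForms lam φ u = true then sgn u else 0) =
      ∑ v : Fin K → ZMod p, (if φ v = true then ∑ u : Fin m → Bool, (if linForms lam u = v then sgn u else 0)
        else 0) := by
    have h1 : ∀ u : Fin m → Bool, (if ofForms lam φ u = true then sgn u else 0) =
        ∑ v : Fin K → ZMod p, (if linForms lam u = v then (if φ v = true then sgn u else 0) else 0) := by
      intro u
      rw [Finset.sum_ite_eq univ (linForms lam u) (fun v => if φ v = true then sgn u else 0), if_pos (mem_univ _)]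
      rfl
    simp_rw [h1]
    rw [Finset.sum_comm]
    refine sum_congr rfl fun v _ => ?_
    by_cases hv : φ v = true
    · simp only [hv, if_true]
    · simp [hv]
  have hnorm : ‖(((evenPart (ofForms lam φ)).card : ℝ) : ℂ) - (((oddPart (ofForms lam φ)).card : ℝ) : ℂ)‖ ≤
      (p : ℝ) ^ K * (2 * Real.cos (Real.pi / (2 * p))) ^ m := by
    rw [hEO, hcells]
    refine (norm_sum_le _ _).trans ?_
    have hv : ∀ v : Fin K → ZMod p, ‖(if φ v = true then
        ∑ u : Fin m → Bool, (if linForms lam u = v then sgn u else 0) else 0)‖ ≤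
        (2 * Real.cos (Real.pi / (2 * p))) ^ m := by
      intro v
      by_cases hφ : φ v = true
      · rw [if_pos hφ]; exact norm_cell_sign_sum_le_mod p hp2 lam v
      · rw [if_neg hφ, norm_zero]
        exact le_trans (norm_nonneg _) (norm_cell_sign_sum_le_mod p hp2 lam v)
    refine (sum_le_sum fun v _ => hv v).trans (le_of_eq ?_)
    rw [sum_const, card_univ, nsmul_eq_mul, Fintype.card_fun, ZMod.card, Fintype.card_fin]
    push_cast; ring
  rw [← Complex.ofReal_sub, Complex.norm_real, Real.norm_eq_abs] at hnorm
  exact hnorm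

/-- prime-modulus form of `abs_sub_parts_ofForms_le_mod`. -/
theorem abs_sub_parts_ofForms_le (p : ℕ) [hp : Fact p.Prime] (hp2 : p ≠ 2) {K : ℕ} (lam : Fin K → Fin m → ZMod p)
    (φ : (Fin K → ZMod p) → Bool) :
    |((evenPart (ofForms lam φ)).card : ℝ) - (oddPart (ofForms lam φ)).card| ≤
      (p : ℝ) ^ K * (2 * Real.cos (Real.pi / (2 * p))) ^ m := by
  haveI : NeZero p := ⟨hp.out.ne_zero⟩
  exact abs_sub_parts_ofForms_le_mod p ((Nat.coprime_primes hp.out Nat.prime_two).2 hp2) lam φ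

/-- **FUNCTIONS OF FEW LINEAR FORMS modulo ANY ODD `q` OBEY A LINEAR LAW (PROVED; the degree prime `p` and the
modulus `q` are DECOUPLED).**  Every Boolean function of `K` linear forms `mod q` (`q` odd, e.g. `q = p^e` or a
composite) of `𝔽_p`-degree `≤ d` (`p` any prime) on `m ≥ 2q²·(d + 1 + K(log₂ q + 1))` bits is `3`-balanced. -/
theorem relBal_three_ofForms_mod (p : ℕ) [hp : Fact p.Prime] {q : ℕ} [NeZero q] (hq2 : q.Coprime 2) {K d : ℕ}
    (lam : Fin K → Fin m → ZMod q) (φ : (Fin K → ZMod q) → Bool) (hf : HasDegF p (ofForms lam φ) d)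
    (hm : 2 * q ^ 2 * (d + 1 + K * (Nat.log 2 q + 1)) ≤ m) : RelBal 3 (ofForms lam φ) := by
  set f := ofForms lam φ with hfdef
  have hq1 : 1 ≤ q := Nat.pos_of_ne_zero (NeZero.ne q)
  have hdm : d ≤ m := by
    have h1 : d + 1 + K * (Nat.log 2 q + 1) ≤ m :=
      le_trans (Nat.le_mul_of_pos_left _ (by positivity)) hm
    omega
  set P : CubeFn (ZMod p) m := fun x => if f x = true then (1 : ZMod p) else 0 with hPdef
  have hP : P ∈ lowDeg (ZMod p) m d := hf
  set a := (oddPart f).card with ha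
  set b := (evenPart f).card with hb
  by_cases hP0 : P = 0
  · have hzero : ∀ z, f z = false := by
      intro z; have hz := congrFun hP0 z
      simp only [hPdef, Pi.zero_apply] at hz
      cases hfz : f z
      · rfl
      · rw [hfz, if_pos rfl] at hz; exact absurd hz one_ne_zero
    exact relBal_of_forall_false hzero
  have hsupp : 2 ^ (m - d) ≤ a + b := by
    have h := two_pow_le_card_support hP hP0
    rw [← card_level_eq f]
    refine h.trans (le_of_eq (congrArg Finset.card (Finset.filter_congr fun x _ => ?_)))
    simp only [hPdef]
    cases f x <;> simp
  have hbias := abs_sub_parts_ofForms_le_mod q hq2 lam φ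
  rw [← hfdef, ← ha, ← hb] at hbias
  -- `2 · q^K · (2cos)^m ≤ 2^{m-d}`
  have hQ : 2 ^ (d + 1) * q ^ K ≤ 2 ^ (d + 1 + K * (Nat.log 2 q + 1)) := by
    rw [pow_add 2 (d + 1), mul_comm K, pow_mul]
    exact Nat.mul_le_mul_left _ (Nat.pow_le_pow_left (Nat.lt_pow_succ_log_self (by norm_num) q).le K)
  have hcos := cos_pow_le_of_log q m (2 ^ (d + 1) * q ^ K) (d + 1 + K * (Nat.log 2 q + 1)) hq1 hQ hm
  have hpow : (2 : ℝ) ^ (m - d) * 2 ^ d = 2 ^ m := by rw [← pow_add, Nat.sub_add_cancel hdm]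
  have hsmall : 2 * ((q : ℝ) ^ K * (2 * Real.cos (Real.pi / (2 * q))) ^ m) ≤ 2 ^ (m - d) := by
    have h2d : (0 : ℝ) < 2 ^ d := by positivity
    rw [← hpow] at hcos
    push_cast at hcos
    have : (2 * ((q : ℝ) ^ K * (2 * Real.cos (Real.pi / (2 * q))) ^ m)) * 2 ^ d ≤ 2 ^ (m - d) * 2 ^ d := by
      calc _ = 2 ^ (d + 1) * (q : ℝ) ^ K * (2 * Real.cos (Real.pi / (2 * q))) ^ m := by ring
        _ ≤ _ := hcos
    exact le_of_mul_le_mul_right this h2d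
  have hsuppR : ((2 ^ (m - d) : ℕ) : ℝ) ≤ ((a + b : ℕ) : ℝ) := by exact_mod_cast hsupp
  push_cast at hsuppR
  have hab := (abs_le.1 hbias)
  have h1 : (a : ℝ) ≤ 3 * b := by linarith [hab.1, hab.2]
  have h2 : (b : ℝ) ≤ 3 * a := by linarith [hab.1, hab.2]
  exact ⟨by exact_mod_cast h1, by exact_mod_cast h2⟩

/-- **FUNCTIONS OF FEW LINEAR FORMS OBEY A LINEAR LAW (PROVED).**  For an odd prime `p`, every Boolean function of
`K` linear forms `mod p` of `𝔽_p`-degree `≤ d` on `m ≥ 2p²·(d + 1 + K(log₂ p + 1))` bits is `3`-balanced: the bias is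
`≤ p^K (2cos(π/2p))^m ≤ p^K 2^m e^{−m/2p²}` (cell sign sums) while a non-empty degree-`d` level set has `≥ 2^{m−d}`
points (DLSZ).  This is the first SPARSE ASYMMETRIC class of the dial (cells of `K` forms have density `≈ p^{−K}`;
the coefficients are arbitrary), with threshold LINEAR in `d`.  (`= relBal_three_ofForms_mod` with `q = p`.) -/
theorem relBal_three_ofForms (p : ℕ) [hp : Fact p.Prime] (hp2 : p ≠ 2) {K d : ℕ} (lam : Fin K → Fin m → ZMod p)
    (φ : (Fin K → ZMod p) → Bool) (hf : HasDegF p (ofForms lam φ) d)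
    (hm : 2 * p ^ 2 * (d + 1 + K * (Nat.log 2 p + 1)) ≤ m) : RelBal 3 (ofForms lam φ) := by
  haveI : NeZero p := ⟨hp.out.ne_zero⟩
  exact relBal_three_ofForms_mod p ((Nat.coprime_primes hp.out Nat.prime_two).2 hp2) lam φ hf hm

/-- **THE LAW ON THE RANK-`≤ K` CLASS, `B = 1` (PROVED):** for an odd prime `p` and every `K` there is `A` (namely
`2p²(1 + K(log₂ p + 1))`) such that every function of `K` linear forms `mod p` of degree `≤ d` on `m ≥ A(d+1)` bits is
`3`-balanced. -/
theorem relSmolLaw_one_ofForms (p : ℕ) [hp : Fact p.Prime] (hp2 : p ≠ 2) (K : ℕ) :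
    ∃ A : ℕ, ∀ m d : ℕ, A * (d + 1) ^ 1 ≤ m → ∀ (lam : Fin K → Fin m → ZMod p) (φ : (Fin K → ZMod p) → Bool),
      HasDegF p (ofForms lam φ) d → RelBal 3 (ofForms lam φ) := by
  refine ⟨2 * p ^ 2 * (1 + K * (Nat.log 2 p + 1)), fun m d hm lam φ hf => relBal_three_ofForms p hp2 lam φ hf ?_⟩
  rw [pow_one] at hm
  refine le_trans ?_ hm
  have h : d + 1 + K * (Nat.log 2 p + 1) ≤ (1 + K * (Nat.log 2 p + 1)) * (d + 1) := by
    nlinarith [Nat.zero_le d, Nat.zero_le (K * (Nat.log 2 p + 1))]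
  calc 2 * p ^ 2 * (d + 1 + K * (Nat.log 2 p + 1)) ≤ 2 * p ^ 2 * ((1 + K * (Nat.log 2 p + 1)) * (d + 1)) :=
        Nat.mul_le_mul_left _ h
    _ = 2 * p ^ 2 * (1 + K * (Nat.log 2 p + 1)) * (d + 1) := by ring

/-- weight readers `mod p` are the case `K = 1`, `λ ≡ 1`: `ofForms (fun _ _ => 1) φ u = φ (fun _ => wt u mod p)`. -/
theorem ofForms_const_one {p : ℕ} (φ : (Fin 1 → ZMod p) → Bool) (u : Fin m → Bool) :
    ofForms (fun (_ : Fin 1) (_ : Fin m) => (1 : ZMod p)) φ u = φ (fun _ => ((wt u : ℕ) : ZMod p)) := by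
  unfold ofForms linForms wt
  congr 1; funext j
  rw [Finset.sum_ite, sum_const_zero, add_zero, sum_const, nsmul_eq_mul, mul_one]

end LinearForms


end Summit.QuantumAdvantage.QuantumAdvantage.Theorems.PurityDialLaw
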